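import Mathlib
import Summits.Ventures.HodgeRepro2.Hypothesis
import Summits.Ventures.HodgeRepro2.Neat
import Summits.Ventures.HodgeRepro2.NeatTorsionFree
import Summits.Ventures.HodgeRepro2.CongruenceNeat

/-!
# NeatCorollaries — neatness is hereditary; `Γ(N)` and all its subsets are torsion-free
(DR15 Lemma 1.1 + Lemma 1.4 assembled; the «sufficiently small level» sentence of T4-B5 / N1 H11)

With `NeatTorsionFree.lean` (neat ⇒ torsion-free) and `CongruenceNeat.lean` (`Γ(N)` neat for
`N > 2`) on the tree, this file records the assembled statements the record uses:

* `IsNeat.mono` — a subset of a neat set is neat (neatness is elementwise);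
* `IsTorsionFreeSet.mono` — likewise for torsion-freeness;
* `isNeat_principalCongruence` — `Γ(N)` is neat for `2 < N` (restated from `dr15Lemma14Shape`);
* **`isTorsionFreeSet_principalCongruence`** — `Γ(N)` is torsion-free for `2 < N`;
* **`isNeat_of_subset_principalCongruence`**, **`isTorsionFreeSet_of_subset_principalCongruence`**
  — every subset of `Γ(N)` (`2 < N`) is neat and torsion-free: «a sufficiently small level is
  neat, and its arithmetic groups act freely»;
* `eq_one_of_mem_principalCongruence_of_pow_eq_one` — the elementwise form: an element of
  `Γ(N)`, `N > 2`, of finite order is `1`.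
-/

namespace Summit.Ventures.HodgeRepro2.ShimuraData

variable {K : Type*} [Field K] {m : ℕ}

/-- Neatness is inherited by subsets. -/
theorem IsNeat.mono (τ : K →+* ℂ) {Γ Γ' : Set (GL (Fin m) K)} (h : IsNeat K τ Γ)
    (hsub : Γ' ⊆ Γ) : IsNeat K τ Γ' :=
  fun γ hγ => h γ (hsub hγ)

/-- Torsion-freeness is inherited by subsets. -/
theorem IsTorsionFreeSet.mono {Γ Γ' : Set (GL (Fin m) K)} (h : IsTorsionFreeSet K Γ)
    (hsub : Γ' ⊆ Γ) : IsTorsionFreeSet K Γ' :=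
  fun γ hγ => h γ (hsub hγ)

variable [NumberField K] [NumberField.IsCMField K]

/-- `Γ(N)` is neat for `N > 2` (DR15 Lemma 1.4). -/
theorem isNeat_principalCongruence (τ : K →+* ℂ) (H : Matrix (Fin m) (Fin m) K) {N : ℕ}
    (hN : 2 < N) :
    IsNeat K τ (principalCongruence K H (Ideal.span {(N : NumberField.RingOfIntegers K)})) :=
  dr15Lemma14Shape τ H N hN

/-- **`Γ(N)` is torsion-free for `N > 2`** (DR15 Lemma 1.4 + Lemma 1.1). -/
theorem isTorsionFreeSet_principalCongruence (τ : K →+* ℂ) (H : Matrix (Fin m) (Fin m) K)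
    {N : ℕ} (hN : 2 < N) :
    IsTorsionFreeSet K
      (principalCongruence K H (Ideal.span {(N : NumberField.RingOfIntegers K)})) :=
  neatImpliesTorsionFree τ _ (isNeat_principalCongruence τ H hN)

/-- Every subset of `Γ(N)`, `N > 2`, is neat. -/
theorem isNeat_of_subset_principalCongruence (τ : K →+* ℂ) (H : Matrix (Fin m) (Fin m) K)
    {N : ℕ} (hN : 2 < N) {Γ : Set (GL (Fin m) K)}
    (hΓ : Γ ⊆ principalCongruence K H (Ideal.span {(N : NumberField.RingOfIntegers K)})) :
    IsNeat K τ Γ :=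
  (isNeat_principalCongruence τ H hN).mono τ hΓ

/-- **Every subset of `Γ(N)`, `N > 2`, is torsion-free** — the arithmetic groups of a
sufficiently small level act freely. -/
theorem isTorsionFreeSet_of_subset_principalCongruence (τ : K →+* ℂ)
    (H : Matrix (Fin m) (Fin m) K) {N : ℕ} (hN : 2 < N) {Γ : Set (GL (Fin m) K)}
    (hΓ : Γ ⊆ principalCongruence K H (Ideal.span {(N : NumberField.RingOfIntegers K)})) :
    IsTorsionFreeSet K Γ :=
  (isTorsionFreeSet_principalCongruence τ H hN).mono hΓ

/-- The elementwise form: an element of `Γ(N)`, `N > 2`, of finite order is `1`. -/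
theorem eq_one_of_mem_principalCongruence_of_pow_eq_one (τ : K →+* ℂ)
    (H : Matrix (Fin m) (Fin m) K) {N : ℕ} (hN : 2 < N) {γ : GL (Fin m) K}
    (hγ : γ ∈ principalCongruence K H (Ideal.span {(N : NumberField.RingOfIntegers K)}))
    {n : ℕ} (hn : 0 < n) (hpow : γ ^ n = 1) : γ = 1 :=
  isTorsionFreeSet_principalCongruence τ H hN γ hγ n hn hpow

end Summit.Ventures.HodgeRepro2.ShimuraData
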